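import Literature.AnabelianGeometry.SemiGraphs.TemperedQuasiGeometricOfShadows
import Literature.AnabelianGeometry.SemiGraphs.TemperedReconstructionCor39UpToTwistAssemblyAt
import HarnessLib

/-!
# [SemiAnbd] Cor. 3.9 (b) AT ONE TEMPERED PAIR from the verticial / edge-like SHADOWS of `φ` — the
# producer-side discharge of the Thm 5.4 junction binder `hCor39c` at chart level (proof-only)

Mochizuki, *Semi-graphs of anabelioids*, Publ. RIMS **42** (2006), §3, Def. 3.8 and Cor. 3.9, proof
pp. 42–43 [cite: MochizukiSemiAnbd2006, Cor 3.9 pp.42-43]; Thm. 3.7 (iii), (iv) pp. 40–41 (print's proof of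
(iii) covers FINITE `𝔾`; cell ruling φ2).

PROOF-ONLY (abc-iut cell wave-4 seat abc-iut-w4-d080, L3-lead ruling α18-4 «`TemperedCor39cDischargeAt`»;
finding W4d083-F2 / F2-SHAPES (R3) of abc-iut-w4-d083).  The [SemiAnbd] Thm. 5.4 (iii) chain (abc-iut-w5-d141
`Thm54iii.clause3Compat_of_geometric`) consumes the geometric Cor. 3.9 (b) at the kernels through a binder
`hCor39c` whose three antecedents are the SHADOWS of a continuous `φ : π₁^temp(G) → π₁^temp(H)`: (hV) every
verticial subgroup of `G` maps onto an open subgroup of a verticial subgroup of `H`; (hE) every nontrivial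
edge-like subgroup of a closed edge of `G` maps onto an open subgroup of an edge-like subgroup of a closed
edge of `H`; (hC) two distinct verticial subgroups of `G` meeting non-trivially go INTO two distinct
verticial subgroups of `H` (the compatibility clause of the compatible reading of Def. 3.8, ruling χ2 — the
clause the literal reading lacks, findings t2g2-F1 / W4d083-F1).  This file composes, AT ONE PAIR `(G, H)`
satisfying the hypotheses of Cor. 3.9 and MODULO Thm. 3.7 (iii) AT `G` AND AT `H` ALONE:
shadows ⟹ `IsCompatiblyQuasiGeometric φ` (abc-iut-w4-d083 `isCompatiblyQuasiGeometric_of_shadows(')`,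
Thm. 3.7 (iv) at a graph from (iii) at that graph by abc-iut-w4-d075's
`maximalCompactIffVerticialAt_of_compactInVerticialAt`) ⟹ `φ` is induced UP TO TWIST by a locally open
morphism `F : G → H` of semi-graphs of anabelioids (`exists_hom_chartPullbackWith_iso_of_isCompatiblyQuasiGeometricAt`,
`TemperedReconstructionCor39UpToTwistAssemblyAt.lean`), whose underlying morphism of semi-graphs is UNIQUE
(`base_eq_of_exists_chartPullbackWith_iso'`) and with which `φ` is compatible up to conjugation on every
verticial and every edge homomorphism (R1, `Hom.compat_of_chartPullbackWith_iso` — the Prop. 3.6 (iv)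
unfolding at the vertices and edges); and conversely the shadows of an induced `φ` (nothing is lost).
The remaining transport from the kernel-level binder `hCor39c` of the arithmetic chain to these chart-level
shadows (the dictionary «maximal compact subgroups of `Ker aug` = geometric verticial subgroups») is the
T54 producer's (abc-iut-w4-d053 / abc-iut-L3-d4), not done here.  No definitions, no new named fact;
nothing here asserts Thm. 3.7 (iii) for an infinite `𝔾` or [SemiAnbd] Thm. 5.4; nothing takes a side on
[IUTchIII] Cor. 3.12; typed ≠ discharged.
-/

open CategoryTheory

namespace Literature.AnabelianGeometry.SemiGraphs

namespace ProfiniteSemiGraph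

universe u

variable {𝒢 ℋ : ProfiniteSemiGraph.{u}}

/-- **Cor. 3.9 (b) at the pair `(G, H)` from the shadows of `φ`, modulo Thm. 3.7 (iii) AT `G` and AT
`H`**: if the verticial subgroups, the nontrivial edge-like subgroups of closed edges, and the
non-trivially-meeting pairs of distinct verticial subgroups of `π₁^temp(G)` have the shadows (hV), (hE),
(hC) under `φ`, then `φ` is induced, for some family `θ` of conjugating elements, by a locally open
morphism `F : G → H` of semi-graphs of anabelioids (`B^temp(φ) ≅ c_H⁻¹ ⋙ F^*_θ ⋙ c_G`).
[cite: MochizukiSemiAnbd2006, Cor 3.9 pp.42-43] -/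
theorem exists_hom_chartPullbackWith_iso_of_shadowsAt (h𝒢iii : CompactInVerticialAt 𝒢)
    (hℋiii : CompactInVerticialAt ℋ) (h𝒢 : Cor39Hypotheses 𝒢) (hℋ : Cor39Hypotheses ℋ)
    (c𝒢 : TemperedPiChart 𝒢) (cℋ : TemperedPiChart ℋ) (φ : c𝒢.G →ₜ* cℋ.G)
    (hV : ∀ (v : 𝒢.graph.Vertex) (K : Subgroup c𝒢.G), K ∈ verticialSubgroups c𝒢 v →
      ∃ (w : ℋ.graph.Vertex) (K₂ : Subgroup cℋ.G), K₂ ∈ verticialSubgroups cℋ w ∧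
        MapsOntoOpenSubgroupOf φ.toMonoidHom K K₂)
    (hE : ∀ (e : 𝒢.graph.Edge) (L : Subgroup c𝒢.G), 𝒢.graph.IsClosedEdge e →
      L ∈ edgeLikeSubgroups c𝒢 e → L ≠ ⊥ →
      ∃ (e' : ℋ.graph.Edge) (L₂ : Subgroup cℋ.G), ℋ.graph.IsClosedEdge e' ∧
        L₂ ∈ edgeLikeSubgroups cℋ e' ∧ L₂ ≠ ⊥ ∧ MapsOntoOpenSubgroupOf φ.toMonoidHom L L₂)
    (hC : ∀ (v₁ v₂ : 𝒢.graph.Vertex) (K₁ H₁ : Subgroup c𝒢.G), K₁ ∈ verticialSubgroups c𝒢 v₁ →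
      H₁ ∈ verticialSubgroups c𝒢 v₂ → K₁ ≠ H₁ → K₁ ⊓ H₁ ≠ ⊥ →
      ∃ (w₁ w₂ : ℋ.graph.Vertex) (K₂ H₂ : Subgroup cℋ.G), K₂ ∈ verticialSubgroups cℋ w₁ ∧
        H₂ ∈ verticialSubgroups cℋ w₂ ∧ K₂ ≠ H₂ ∧ K₁.map φ.toMonoidHom ≤ K₂ ∧ H₁.map φ.toMonoidHom ≤ H₂) :
    ∃ F : Hom 𝒢 ℋ, F.IsLocallyOpen ∧
      ∃ θ : F.ConjugatorFamily, Nonempty (F.chartPullbackWith θ c𝒢 cℋ ≅ BTemp.res φ) :=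
  exists_hom_chartPullbackWith_iso_of_isCompatiblyQuasiGeometricAt h𝒢iii hℋiii h𝒢 hℋ c𝒢 cℋ φ
    (isCompatiblyQuasiGeometric_of_shadows (maximalCompactIffVerticialAt_of_compactInVerticialAt h𝒢iii)
      (maximalCompactIffVerticialAt_of_compactInVerticialAt hℋiii) h𝒢.thm37Hypotheses hℋ.thm37Hypotheses
      c𝒢 cℋ φ hV hE hC)

/-- **The same without the nontriviality of the target in (hE)** (edge-like subgroups of `π₁^temp(H)` are
infinite, abc-iut-w4-d083 `isCompatiblyQuasiGeometric_of_shadows'`): the shape in which the arithmetic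
chain's binder `hCor39c` states its second antecedent. [cite: MochizukiSemiAnbd2006, Cor 3.9 pp.42-43] -/
theorem exists_hom_chartPullbackWith_iso_of_shadowsAt' (h𝒢iii : CompactInVerticialAt 𝒢)
    (hℋiii : CompactInVerticialAt ℋ) (h𝒢 : Cor39Hypotheses 𝒢) (hℋ : Cor39Hypotheses ℋ)
    (c𝒢 : TemperedPiChart 𝒢) (cℋ : TemperedPiChart ℋ) (φ : c𝒢.G →ₜ* cℋ.G)
    (hV : ∀ (v : 𝒢.graph.Vertex) (K : Subgroup c𝒢.G), K ∈ verticialSubgroups c𝒢 v →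
      ∃ (w : ℋ.graph.Vertex) (K₂ : Subgroup cℋ.G), K₂ ∈ verticialSubgroups cℋ w ∧
        MapsOntoOpenSubgroupOf φ.toMonoidHom K K₂)
    (hE : ∀ (e : 𝒢.graph.Edge) (L : Subgroup c𝒢.G), 𝒢.graph.IsClosedEdge e →
      L ∈ edgeLikeSubgroups c𝒢 e → L ≠ ⊥ →
      ∃ (e' : ℋ.graph.Edge) (L₂ : Subgroup cℋ.G), ℋ.graph.IsClosedEdge e' ∧
        L₂ ∈ edgeLikeSubgroups cℋ e' ∧ MapsOntoOpenSubgroupOf φ.toMonoidHom L L₂)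
    (hC : ∀ (v₁ v₂ : 𝒢.graph.Vertex) (K₁ H₁ : Subgroup c𝒢.G), K₁ ∈ verticialSubgroups c𝒢 v₁ →
      H₁ ∈ verticialSubgroups c𝒢 v₂ → K₁ ≠ H₁ → K₁ ⊓ H₁ ≠ ⊥ →
      ∃ (w₁ w₂ : ℋ.graph.Vertex) (K₂ H₂ : Subgroup cℋ.G), K₂ ∈ verticialSubgroups cℋ w₁ ∧
        H₂ ∈ verticialSubgroups cℋ w₂ ∧ K₂ ≠ H₂ ∧ K₁.map φ.toMonoidHom ≤ K₂ ∧ H₁.map φ.toMonoidHom ≤ H₂) :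
    ∃ F : Hom 𝒢 ℋ, F.IsLocallyOpen ∧
      ∃ θ : F.ConjugatorFamily, Nonempty (F.chartPullbackWith θ c𝒢 cℋ ≅ BTemp.res φ) :=
  exists_hom_chartPullbackWith_iso_of_isCompatiblyQuasiGeometricAt h𝒢iii hℋiii h𝒢 hℋ c𝒢 cℋ φ
    (isCompatiblyQuasiGeometric_of_shadows' (maximalCompactIffVerticialAt_of_compactInVerticialAt h𝒢iii)
      (maximalCompactIffVerticialAt_of_compactInVerticialAt hℋiii) h𝒢.thm37Hypotheses hℋ.thm37Hypotheses
      c𝒢 cℋ φ hV hE hC)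

/-- **The full per-pair package for the junction**: from the shadows (second antecedent in the primed
shape), a locally open `F : G → H` inducing `φ` up to twist, TOGETHER WITH the Prop. 3.6 (iv) unfolding —
`φ` is compatible up to `π₁^temp(H)`-conjugation with `F` on every verticial and every edge homomorphism
(`φ (ψ_v x) = g·ψ_{F v}(F_v x)·g⁻¹`, R1 `Hom.compat_of_chartPullbackWith_iso`) — and the UNIQUENESS of the
underlying morphism of semi-graphs among all locally open morphisms inducing `φ` up to twist
(`base_eq_of_exists_chartPullbackWith_iso'`).  Modulo Thm. 3.7 (iii) AT `G` and AT `H` alone.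
[cite: MochizukiSemiAnbd2006, Cor 3.9 pp.42-43] -/
theorem exists_hom_compat_unique_of_shadowsAt (h𝒢iii : CompactInVerticialAt 𝒢)
    (hℋiii : CompactInVerticialAt ℋ) (h𝒢 : Cor39Hypotheses 𝒢) (hℋ : Cor39Hypotheses ℋ)
    (c𝒢 : TemperedPiChart 𝒢) (cℋ : TemperedPiChart ℋ) (φ : c𝒢.G →ₜ* cℋ.G)
    (hV : ∀ (v : 𝒢.graph.Vertex) (K : Subgroup c𝒢.G), K ∈ verticialSubgroups c𝒢 v →
      ∃ (w : ℋ.graph.Vertex) (K₂ : Subgroup cℋ.G), K₂ ∈ verticialSubgroups cℋ w ∧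
        MapsOntoOpenSubgroupOf φ.toMonoidHom K K₂)
    (hE : ∀ (e : 𝒢.graph.Edge) (L : Subgroup c𝒢.G), 𝒢.graph.IsClosedEdge e →
      L ∈ edgeLikeSubgroups c𝒢 e → L ≠ ⊥ →
      ∃ (e' : ℋ.graph.Edge) (L₂ : Subgroup cℋ.G), ℋ.graph.IsClosedEdge e' ∧
        L₂ ∈ edgeLikeSubgroups cℋ e' ∧ MapsOntoOpenSubgroupOf φ.toMonoidHom L L₂)
    (hC : ∀ (v₁ v₂ : 𝒢.graph.Vertex) (K₁ H₁ : Subgroup c𝒢.G), K₁ ∈ verticialSubgroups c𝒢 v₁ →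
      H₁ ∈ verticialSubgroups c𝒢 v₂ → K₁ ≠ H₁ → K₁ ⊓ H₁ ≠ ⊥ →
      ∃ (w₁ w₂ : ℋ.graph.Vertex) (K₂ H₂ : Subgroup cℋ.G), K₂ ∈ verticialSubgroups cℋ w₁ ∧
        H₂ ∈ verticialSubgroups cℋ w₂ ∧ K₂ ≠ H₂ ∧ K₁.map φ.toMonoidHom ≤ K₂ ∧ H₁.map φ.toMonoidHom ≤ H₂) :
    ∃ F : Hom 𝒢 ℋ, F.IsLocallyOpen ∧
      (∃ θ : F.ConjugatorFamily, Nonempty (F.chartPullbackWith θ c𝒢 cℋ ≅ BTemp.res φ)) ∧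
      F.CompatV c𝒢 cℋ φ ∧ F.CompatE c𝒢 cℋ φ ∧
      ∀ F' : Hom 𝒢 ℋ, F'.IsLocallyOpen →
        (∃ θ' : F'.ConjugatorFamily, Nonempty (F'.chartPullbackWith θ' c𝒢 cℋ ≅ BTemp.res φ)) →
          F'.base = F.base := by
  obtain ⟨F, hF, θ, hθ⟩ :=
    exists_hom_chartPullbackWith_iso_of_shadowsAt' h𝒢iii hℋiii h𝒢 hℋ c𝒢 cℋ φ hV hE hC
  obtain ⟨hcV, hcE⟩ := F.compat_of_chartPullbackWith_iso θ c𝒢 cℋ φ hθ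
  exact ⟨F, hF, ⟨θ, hθ⟩, hcV, hcE, fun F' hF' hind' =>
    base_eq_of_exists_chartPullbackWith_iso' h𝒢 hℋ c𝒢 cℋ F F' φ hF hF' ⟨θ, hθ⟩ hind'⟩

/-- **Converse: the shadows of an induced homomorphism** (nothing is lost at the junction): a `φ`
induced up to twist by a locally open `F : G → H` has the shadows (hV), (hE), (hC) — (a) of Cor. 3.9 at
the pair (`isCompatiblyQuasiGeometric_of_exists_chartPullbackWith_isoAt`) followed by abc-iut-w4-d083's
`shadows_of_isCompatiblyQuasiGeometric`.  Modulo Thm. 3.7 (iii) AT `G` and AT `H`.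
[cite: MochizukiSemiAnbd2006, Cor 3.9 pp.42-43] -/
theorem shadows_of_exists_chartPullbackWith_isoAt (h𝒢iii : CompactInVerticialAt 𝒢)
    (hℋiii : CompactInVerticialAt ℋ) (h𝒢 : Cor39Hypotheses 𝒢) (hℋ : Cor39Hypotheses ℋ)
    (c𝒢 : TemperedPiChart 𝒢) (cℋ : TemperedPiChart ℋ) (F : Hom 𝒢 ℋ) (φ : c𝒢.G →ₜ* cℋ.G)
    (hF : F.IsLocallyOpen)
    (hind : ∃ θ : F.ConjugatorFamily, Nonempty (F.chartPullbackWith θ c𝒢 cℋ ≅ BTemp.res φ)) :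
    (∀ (v : 𝒢.graph.Vertex) (K : Subgroup c𝒢.G), K ∈ verticialSubgroups c𝒢 v →
      ∃ (w : ℋ.graph.Vertex) (K₂ : Subgroup cℋ.G), K₂ ∈ verticialSubgroups cℋ w ∧
        MapsOntoOpenSubgroupOf φ.toMonoidHom K K₂) ∧
    (∀ (e : 𝒢.graph.Edge) (L : Subgroup c𝒢.G), 𝒢.graph.IsClosedEdge e →
      L ∈ edgeLikeSubgroups c𝒢 e → L ≠ ⊥ →
      ∃ (e' : ℋ.graph.Edge) (L₂ : Subgroup cℋ.G), ℋ.graph.IsClosedEdge e' ∧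
        L₂ ∈ edgeLikeSubgroups cℋ e' ∧ L₂ ≠ ⊥ ∧ MapsOntoOpenSubgroupOf φ.toMonoidHom L L₂) ∧
    (∀ (v₁ v₂ : 𝒢.graph.Vertex) (K₁ H₁ : Subgroup c𝒢.G), K₁ ∈ verticialSubgroups c𝒢 v₁ →
      H₁ ∈ verticialSubgroups c𝒢 v₂ → K₁ ≠ H₁ → K₁ ⊓ H₁ ≠ ⊥ →
      ∃ (w₁ w₂ : ℋ.graph.Vertex) (K₂ H₂ : Subgroup cℋ.G), K₂ ∈ verticialSubgroups cℋ w₁ ∧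
        H₂ ∈ verticialSubgroups cℋ w₂ ∧ K₂ ≠ H₂ ∧ K₁.map φ.toMonoidHom ≤ K₂ ∧
        H₁.map φ.toMonoidHom ≤ H₂) :=
  shadows_of_isCompatiblyQuasiGeometric (maximalCompactIffVerticialAt_of_compactInVerticialAt h𝒢iii)
    (maximalCompactIffVerticialAt_of_compactInVerticialAt hℋiii) h𝒢.thm37Hypotheses hℋ.thm37Hypotheses
    c𝒢 cℋ (isCompatiblyQuasiGeometric_of_exists_chartPullbackWith_isoAt h𝒢iii hℋiii h𝒢 hℋ c𝒢 cℋ F φ hF hind)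

end ProfiniteSemiGraph

end Literature.AnabelianGeometry.SemiGraphs
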